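import Literature.Probability.LatticeModels.CriticalAxisRatioRegularity
import Literature.Probability.LatticeModels.MessagerMiracleSoleFree
import Literature.Probability.LatticeModels.CriticalTwoPointBounds
import Summits.CriticalPhenomena.Ising3DConformalLimit.Theorems.PrecisionLaplacianTwoPointSpineGlueLogConvex
import HarnessLib

/-!
# Crux `InverseSquareLaw` (stmt-CriticalPhenomena-4495), line `registered` — at an axis site the
# lattice Laplacian of the critical two-point function is the sum of a NONNEGATIVE axial and
# NONPOSITIVE transverse second differences

Route `InverseSquareTelemetry`, sub-problem `Ising3DConformalLimit`; THEOREM-ONLY helper file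
(lead c3). It records, kernel-checked, the structural reason why no inequality in the tree or in
print decides even the SIGN of `(Δ_{ℤ³}G)(x)` for `G = criticalTwoPoint 3`, let alone the limit of
the telemetry `T(x) = |x|₂² ΔG/G` (stub S1 of the crux):

at an axis site `x = n eᵢ` (`n ≥ 1`),
`(Δ_{ℤ³}G)(x) = [G(x+eᵢ) + G(x−eᵢ) − 2G(x)] + Σ_{j ≠ i} [G(x+eⱼ) + G(x−eⱼ) − 2G(x)]`, where

* the AXIAL second difference is `≥ 0` (`axial_secondDiff_nonneg`): `n ↦ G(n eᵢ)` is log-convex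
  (`criticalTwoPoint_axis_sq_le`: reflection positivity / the spectral representation of
  Aizenman–Duminil-Copin 2021, Prop. 5.3, at `β_c` where `m*(β_c) = 0`), and log-convex nonnegative
  sequences are convex;
* each TRANSVERSE second difference is `≤ 0` (`transverse_secondDiff_nonpos`): `G(n eᵢ ± eⱼ) ≤ G(n eᵢ)`
  by the Messager–Miracle-Solé inequality (`messager_miracleSole_free`, free state `=` plus state at
  `β_c` on `ℤ³`, `SpineGlue.criticalTwoPoint_eq_free`) and reflection symmetry.

For a pure power law `G ≈ A|x|^{−a}`, `a = 1+η`, the two parts are `+a(a+1)·G/n²` and `−2a·G/n²`: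
both of order `G/n²`, of opposite signs, with the telemetric constant `κ = a(a−1) = η(1+η) ≈ 0.038`
their `2%` residual — the cancellation a proof of S1 must control (`axis_laplacian_split`).
-/

noncomputable section

namespace Summit.CriticalPhenomena.Ising3DConformalLimit.Theorems

open Literature.Probability.LatticeModels Finset

namespace AxialSigns

/-- `⟨σ₀σ_{n eᵢ}⟩_{β_c} ≥ 0` on `ℤ³` (Simon–Lieb lower bound off the origin, `= 1` at it). [folklore] -/
theorem criticalTwoPoint_single_nonneg (i : Fin 3) (n : ℤ) :
    0 ≤ criticalTwoPoint 3 (Pi.single i n) := by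
  by_cases hx : (Pi.single i n : Site 3) = 0
  · rw [hx, criticalTwoPoint_zero']; exact zero_le_one
  · obtain ⟨c, C, hc, hb⟩ := criticalTwoPoint_bounds_holds (d := 3) le_rfl
    exact (mul_nonneg hc.le (Real.rpow_nonneg (norm_nonneg _) _)).trans (hb _ hx).1

end AxialSigns

open AxialSigns
open SpineGlue (criticalTwoPoint_eq_free)

/-- **Axial second differences of the critical two-point function are nonnegative.** For `n ≥ 1`,
`G((n+1)eᵢ) + G((n−1)eᵢ) − 2 G(n eᵢ) ≥ 0`, `G = criticalTwoPoint 3`: log-convexity along the axis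
(`criticalTwoPoint_axis_sq_le`, from reflection positivity at `β_c`) and AM–GM
(Mathlib's `two_mul_le_add_of_sq_le_mul`). [folklore] -/
theorem axial_secondDiff_nonneg (i : Fin 3) {n : ℕ} (hn : 1 ≤ n) :
    0 ≤ criticalTwoPoint 3 (Pi.single i ((n + 1 : ℕ) : ℤ)) +
        criticalTwoPoint 3 (Pi.single i ((n - 1 : ℕ) : ℤ)) - 2 * criticalTwoPoint 3 (Pi.single i (n : ℤ)) := by
  have h := _root_.two_mul_le_add_of_sq_le_mul (criticalTwoPoint_single_nonneg i _)
    (criticalTwoPoint_single_nonneg i _) (criticalTwoPoint_axis_sq_le i hn)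
  linarith

/-- **Transverse steps off an axis decrease the critical two-point function** (Messager–Miracle-Solé):
for `j ≠ i` and any `n`, `G(n eᵢ + eⱼ) ≤ G(n eᵢ)` and `G(n eᵢ − eⱼ) ≤ G(n eᵢ)`. [folklore] -/
theorem transverse_step_le (i j : Fin 3) (hij : j ≠ i) (n : ℤ) :
    criticalTwoPoint 3 (Pi.single i n + Pi.single j 1) ≤ criticalTwoPoint 3 (Pi.single i n) ∧
      criticalTwoPoint 3 (Pi.single i n - Pi.single j 1) ≤ criticalTwoPoint 3 (Pi.single i n) := by
  have hβ : 0 ≤ criticalBeta 3 := criticalBeta_nonneg _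
  have hplus : criticalTwoPoint 3 (Pi.single i n + Pi.single j 1) ≤ criticalTwoPoint 3 (Pi.single i n) := by
    rw [criticalTwoPoint_eq_free, criticalTwoPoint_eq_free]
    exact messager_miracleSole_free hβ (Pi.single i n) j (by simp [hij])
  refine ⟨hplus, ?_⟩
  -- reflect the `j`-th coordinate: `G(n eᵢ − eⱼ) = G(n eᵢ + eⱼ)`
  have hupd : Function.update (Pi.single i n + Pi.single j 1 : Site 3) j
      (-((Pi.single i n + Pi.single j 1 : Site 3) j)) = Pi.single i n - Pi.single j 1 := by
    funext k
    by_cases hk : k = j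
    · subst hk
      simp [hij]
    · simp [Pi.single_apply, hk]
  have h := twoPointFree_reflection hβ j (Pi.single i n + Pi.single j 1 : Site 3)
  rw [hupd] at h
  have hrefl : criticalTwoPoint 3 (Pi.single i n - Pi.single j 1) =
      criticalTwoPoint 3 (Pi.single i n + Pi.single j 1) := by
    rw [criticalTwoPoint_eq_free, criticalTwoPoint_eq_free, h]
  rw [hrefl]
  exact hplus

/-- **Transverse second differences at an axis site are nonpositive**: for `j ≠ i`,
`G(n eᵢ + eⱼ) + G(n eᵢ − eⱼ) − 2 G(n eᵢ) ≤ 0`. [folklore] -/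
theorem transverse_secondDiff_nonpos (i j : Fin 3) (hij : j ≠ i) (n : ℤ) :
    criticalTwoPoint 3 (Pi.single i n + Pi.single j 1) +
        criticalTwoPoint 3 (Pi.single i n - Pi.single j 1) - 2 * criticalTwoPoint 3 (Pi.single i n) ≤ 0 := by
  obtain ⟨h1, h2⟩ := transverse_step_le i j hij n
  linarith

/-- **The split of the lattice Laplacian at an axis site.** For `x = n eᵢ` with `n ≥ 1`, the
six-neighbour Laplacian `Σ_k (G(x+e_k) + G(x−e_k)) − 6 G(x)` of `G = criticalTwoPoint 3` equals
`A + B` with `A = G(x+eᵢ)+G(x−eᵢ)−2G(x) ≥ 0` (axial, log-convexity) and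
`B = Σ_{j≠i} (G(x+eⱼ)+G(x−eⱼ)−2G(x)) ≤ 0` (transverse, Messager–Miracle-Solé): the sign of `ΔG`, and a
fortiori the telemetric limit of stub S1, is decided by the competition of two controlled terms of
opposite signs (for `G ≈ A|x|^{−(1+η)}`: `+(1+η)(2+η)G/n²` against `−2(1+η)G/n²`). [folklore] -/
theorem axis_laplacian_split (i : Fin 3) {n : ℕ} (hn : 1 ≤ n) :
    ∃ A B : ℝ, 0 ≤ A ∧ B ≤ 0 ∧
      (∑ k : Fin 3, (criticalTwoPoint 3 (Pi.single i (n : ℤ) + Pi.single k 1) +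
          criticalTwoPoint 3 (Pi.single i (n : ℤ) - Pi.single k 1))) -
        6 * criticalTwoPoint 3 (Pi.single i (n : ℤ)) = A + B := by
  set x : Site 3 := Pi.single i (n : ℤ) with hx
  set G : Site 3 → ℝ := criticalTwoPoint 3 with hG
  -- axial part
  have hax1 : x + Pi.single i 1 = Pi.single i (((n + 1 : ℕ) : ℤ)) := by
    rw [hx, ← Pi.single_add]; push_cast; rfl
  have hax2 : x - Pi.single i 1 = Pi.single i (((n - 1 : ℕ) : ℤ)) := by
    rw [hx, ← Pi.single_sub]
    congr 1
    push_cast [Nat.cast_sub hn]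
    ring
  refine ⟨G (x + Pi.single i 1) + G (x - Pi.single i 1) - 2 * G x,
    ∑ k ∈ (univ : Finset (Fin 3)).erase i, (G (x + Pi.single k 1) + G (x - Pi.single k 1) - 2 * G x),
    ?_, ?_, ?_⟩
  · rw [hax1, hax2]
    exact axial_secondDiff_nonneg i hn
  · refine Finset.sum_nonpos fun k hk => ?_
    exact transverse_secondDiff_nonpos i k (Finset.ne_of_mem_erase hk) n
  · rw [← Finset.add_sum_erase _ _ (Finset.mem_univ i), Finset.sum_sub_distrib,
      Finset.sum_const, Finset.card_erase_of_mem (Finset.mem_univ i)]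
    simp only [Finset.card_univ, Fintype.card_fin, nsmul_eq_mul]
    push_cast
    ring

end Summit.CriticalPhenomena.Ising3DConformalLimit.Theorems
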